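import Summits.CriticalPhenomena.PercolationContinuityZ3.Theorems.Transplant.FKDoubleFanMultifanFinal
import HarnessLib

/-!
# Double fans `K₂ ∨ P_{m+1}`: MULTIFAN₁ with a JUNCTION vertex carrying BOTH spokes — in particular EVERY cross-apex pair at rim distance two,
# with ARBITRARY weights, is negatively correlated (`0 < q ≤ 1`)

Helper file (`--supports stmt-CriticalPhenomena-4575`), FK sub-lane `prim-bschramm-fk-3` (gen 46); builds on p205010 (kernel theorem, internal audit
signed; external expert review pending).  No named facts, no sorries; standard axioms.  Memo `bschramm/prim-bschramm-fk-3/FAR-CROSS-XXI.md` §2.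

`negCorr_spokes_cross_far_multifan` (`…MultifanFinal`, LEMMA‴ = MULTIFAN₁ proved) is stated for middles whose vertices `c_{j+1}, …, c_ℓ` carry
only `a`-spokes and `c_{ℓ+1}, …, c_{k-1}` only `b`-spokes.  The two spokes of ONE rim vertex commute (`A_x B_y = B_y A_x` — both letters are
multiplication operators of the commutative fibre algebra, **`conv_letters_comm`**), so a JUNCTION vertex `c_{ℓ+1}` carrying BOTH spokes is still
a MULTIFAN₁ middle: its `a`-spoke closes the `a`-fan and its `b`-spoke opens the `b`-fan (**`midWord_junction`**, **`midWord_multifan_junction`**,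
**`crossFarZ_multifan_junction`** — the four pinned partition functions are `mfZ` valuations at the fan vectors
`F = BC_{x}∗E_{r}(fanVec ma)`, `G = E_{rd}(fanVecB mb (BC_{y}∗fanInit))`, both in `InKE q`).  Hence, UNCONDITIONALLY (`mfRay_nonneg_inKE`):
* **`negCorr_spokes_cross_far_multifan_junction`**: for every weighted double fan (`card V = m + 3`, weights supported on the double-fan pairs),
  `0 < q ≤ 1`, and all `j ≤ ℓ`, `ℓ + 2 ≤ k ≤ m` with `w(b c_i) = 0` for `j < i ≤ ℓ` and `w(a c_i) = 0` for `ℓ + 1 < i < k` (NO condition at the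
  junction vertex `c_{ℓ+1}`): `φ(J_{a c_j} ∩ J_{b c_k}) ≤ φ(J_{a c_j})·φ(J_{b c_k})`;
* **`negCorr_spokes_cross_two`**, **`negCorr_spokes_cross_two'`** (`ℓ = j`, `k = j + 2`): EVERY cross-apex pair `(a c_j, b c_{j+2})` resp.
  `(b c_j, a c_{j+2})` at rim distance two is negatively correlated, for ALL weights — the distance-two analogue of `negCorr_spokes_cross`
  (`…SpokesCross`, distance one); previously the middle vertex `c_{j+1}` had to miss one of its two spokes.
With `negCorr_spokes_cross`, `negCorr_spokes` (same rim vertex) and the same-apex/rim theorems, every pair of edges of a weighted double fan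
at rim distance `≤ 2` is now negatively correlated unconditionally; distance `3` is the B·A·B pattern of `…FanExchange` (hypothesis `HypBA`).
[cite: Grimmett2006, §3.9 eq. (3.94) (pp. 63–64)] [folklore]
-/

noncomputable section

namespace Summit.CriticalPhenomena.PercolationContinuityZ3.Theorems

namespace FK

namespace ThreeApex

/-! ### The two spokes of one rim vertex commute -/

/-- `AC_x ∗ (BC_y ∗ Z) = BC_y ∗ (AC_x ∗ Z)` (the fibre algebra is commutative). [folklore] -/
theorem conv_letters_comm (x y : ℝ) (Z : V5) : conv (edgeAC x) (conv (edgeBC y) Z) = conv (edgeBC y) (conv (edgeAC x) Z) := by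
  simp only [← mul_def, ← mul_assoc, mul_comm (edgeAC x)]

/-- **One junction block** `(r, x, y)` after an `a`-fan `F`: the rim step and the `a`-spoke extend the `a`-fan, the `b`-spoke opens a `b`-fan —
`midWord q [(r,x,y)] (fanCombo F X) = fanComboB (BC_y ∗ fanInit) (fanCombo (BC_x ∗ E_r F) X)`. [folklore] -/
theorem midWord_junction (q : ℝ) (blk : ℝ × ℝ × ℝ) (F X : V5) :
    midWord q [blk] (fanCombo q F X) =
      fanComboB q (conv (edgeBC blk.2.2) fanInit) (fanCombo q (conv (edgeBC blk.2.1) (rimStep q blk.1 F)) X) := by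
  simp only [midWord, rimStep_fanCombo, conv_letters_comm, conv_edgeAC_fanCombo]
  rw [← conv_edgeBC_fanComboB, fanComboB_init]

/-- **MULTIFAN₁ middles with a junction vertex factor**: an `a`-only list `ma`, then ONE arbitrary block `jb`, then a `b`-only list `mb` act as
`fanComboB G ∘ fanCombo F` with `F = BC_{jb.x} ∗ E_{jb.r}(fanVec q ma fanInit)` and `G = fanVecB q mb (BC_{jb.y} ∗ fanInit)`. [folklore] -/
theorem midWord_multifan_junction (q : ℝ) {ma mb : List (ℝ × ℝ × ℝ)} (ha : ∀ blk ∈ ma, blk.2.2 = 0) (hb : ∀ blk ∈ mb, blk.2.1 = 0)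
    (jb : ℝ × ℝ × ℝ) (X : V5) :
    midWord q (ma ++ jb :: mb) X =
      fanComboB q (fanVecB q mb (conv (edgeBC jb.2.2) fanInit)) (fanCombo q (conv (edgeBC jb.2.1) (rimStep q jb.1 (fanVec q ma fanInit))) X) := by
  have e : jb :: mb = [jb] ++ mb := rfl
  rw [midWord_appendList, midWord_oneSided_init q ha, e, midWord_appendList, midWord_junction, midWord_oneSidedB q hb]

/-- **`crossFarZ` of a MULTIFAN₁ middle with a junction vertex** is the four-leg valuation `mfZ` at the two fan vectors (last rim step in `G`). [folklore] -/
theorem crossFarZ_multifan_junction (q : ℝ) {ma mb : List (ℝ × ℝ × ℝ)} (ha : ∀ blk ∈ ma, blk.2.2 = 0) (hb : ∀ blk ∈ mb, blk.2.1 = 0)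
    (jb : ℝ × ℝ × ℝ) (rd : ℝ) (u s : V5) (σ τ : ℝ) :
    crossFarZ q (ma ++ jb :: mb) rd u s σ τ =
      mfZ q (conv (edgeBC jb.2.1) (rimStep q jb.1 (fanVec q ma fanInit))) (rimStep q rd (fanVecB q mb (conv (edgeBC jb.2.2) fanInit))) u s σ τ := by
  simp only [crossFarZ, mfZ, midWord_multifan_junction q ha hb, rimStep_fanComboB]

open MeasureTheory Literature.Probability.LatticeModels Literature.Probability.Percolation
open scoped Classical

variable {V : Type*} [Fintype V]

omit [Fintype V] in
/-- The first block of a block list: `midBlocks w a b c i 1 = [(w(c_i c_{i+1}), w(a c_{i+1}), w(b c_{i+1}))]`. [folklore] -/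
theorem midBlocks_one (w : Sym2 V → unitInterval) (a b : V) (c : ℕ → V) (i : ℕ) :
    midBlocks w a b c i 1 = [(wR w s(c i, c (i + 1)), wR w s(a, c (i + 1)), wR w s(b, c (i + 1)))] := by
  simp [midBlocks]

section Setting

variable {a b : V} {c : ℕ → V} {m : ℕ}
variable (hab : a ≠ b) (hinj : ∀ j k, j ≤ m → k ≤ m → c j = c k → j = k) (hca : ∀ j, j ≤ m → c j ≠ a) (hcb : ∀ j, j ≤ m → c j ≠ b)
include hab hinj hca hcb

/-- **MULTIFAN₁ WITH A JUNCTION VERTEX — NEGATIVE CORRELATION, UNCONDITIONALLY** (`0 < q ≤ 1`): for every weighted double fan (`card V = m + 3`,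
weights supported on the double-fan pairs) and all `j ≤ ℓ`, `ℓ + 2 ≤ k ≤ m` with `w(b c_i) = 0` for `j < i ≤ ℓ` and `w(a c_i) = 0` for `ℓ + 1 < i < k`
(the junction vertex `c_{ℓ+1}` may carry both spokes), `φ(J_{a c_j} ∩ J_{b c_k}) ≤ φ(J_{a c_j})·φ(J_{b c_k})`. [folklore] -/
theorem negCorr_spokes_cross_far_multifan_junction (hcard : Fintype.card V = m + 3) {q : ℝ} (hq0 : 0 < q) (hq1 : q ≤ 1)
    (w : Sym2 V → unitInterval) (hsupp : ∀ e, e ∉ dfPairs a b c m → w e = 0)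
    {j ℓ k : ℕ} (hjl : j ≤ ℓ) (hlk : ℓ + 2 ≤ k) (hk : k ≤ m) (hb0 : ∀ i, j < i → i ≤ ℓ → w s(b, c i) = 0)
    (ha0 : ∀ i, ℓ + 1 < i → i < k → w s(a, c i) = 0) :
    (rcMeasureW w q ∅).real ({ω : BondConfig V | s(a, c j) ∈ ω} ∩ {ω | s(b, c k) ∈ ω}) ≤
      (rcMeasureW w q ∅).real {ω : BondConfig V | s(a, c j) ∈ ω} * (rcMeasureW w q ∅).real {ω : BondConfig V | s(b, c k) ∈ ω} := by
  obtain ⟨d, rfl⟩ : ∃ d, k = j + d + 1 := ⟨k - j - 1, by omega⟩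
  refine negCorr_spokes_cross_far_of_rayleigh hab hinj hca hcb hcard hq0 w hsupp hk ?_
  have huK : InKE q (conv (edgeBC (wR w s(b, c j))) (blockIn q w a b c j)) :=
    InKE.step (IsLetter.bc (w _).2.1 (w _).2.2) (inKE_blockIn q w a b c j)
  have hsK : InKE q (conv (restVec q w a b c (j + d + 1) (m - (j + d + 1))) (edgeAC (wR w s(a, c (j + d + 1))))) :=
    InKE.mul (inKE_restVec q w a b c (m - (j + d + 1)) (j + d + 1)) (by
      rw [← mul_one (edgeAC (wR w s(a, c (j + d + 1)))), mul_def, one_def]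
      exact InKE.step (IsLetter.ac (w _).2.1 (w _).2.2) InKE.base)
  -- split the block list: `a`-only run (length `ℓ - j`), the junction block at `c_{ℓ+1}`, `b`-only run (length `n₃`)
  set n₁ := ℓ - j with hn₁
  obtain ⟨n₃, hn₃⟩ : ∃ n₃, d = n₁ + (1 + n₃) := ⟨d - n₁ - 1, by omega⟩
  set jb : ℝ × ℝ × ℝ := (wR w s(c (j + n₁), c (j + n₁ + 1)), wR w s(a, c (j + n₁ + 1)), wR w s(b, c (j + n₁ + 1))) with hjb
  have hsplit : midBlocks w a b c j d = midBlocks w a b c j n₁ ++ jb :: midBlocks w a b c (j + n₁ + 1) n₃ := by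
    rw [hn₃, midBlocks_split w a b c j n₁ (1 + n₃), midBlocks_split w a b c (j + n₁) 1 n₃, midBlocks_one, List.singleton_append]
  have hya : ∀ blk ∈ midBlocks w a b c j n₁, blk.2.2 = 0 :=
    midBlocks_bSpoke_zero w a b c j n₁ (fun i hi hi' => hb0 i hi (by omega))
  have hxb : ∀ blk ∈ midBlocks w a b c (j + n₁ + 1) n₃, blk.2.1 = 0 :=
    midBlocks_aSpoke_zero w a b c (j + n₁ + 1) n₃ (fun i hi hi' => ha0 i (by omega) (by omega))
  have hF : InKE q (conv (edgeBC jb.2.1) (rimStep q jb.1 (fanVec q (midBlocks w a b c j n₁) fanInit))) :=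
    InKE.step (IsLetter.bc (w _).2.1 (w _).2.2) (InKE.rim (w _).2.1 (w _).2.2
      (fanVec_inKE (unitBlocks_midBlocks w a b c j n₁) (fanInit_inKE q)))
  have hG : InKE q (rimStep q (wR w s(c (j + d), c (j + d + 1)))
      (fanVecB q (midBlocks w a b c (j + n₁ + 1) n₃) (conv (edgeBC jb.2.2) fanInit))) :=
    InKE.rim (w _).2.1 (w _).2.2 (fanVecB_inKE (unitBlocks_midBlocks w a b c (j + n₁ + 1) n₃)
      (InKE.step (IsLetter.bc (w _).2.1 (w _).2.2) (fanInit_inKE q)))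
  have key := mfRay_nonneg_inKE hq0 hq1 _ _ _ _ hF hG huK hsK
  simp only
  rw [hsplit, crossFarZ_multifan_junction q hya hxb, crossFarZ_multifan_junction q hya hxb, crossFarZ_multifan_junction q hya hxb,
    crossFarZ_multifan_junction q hya hxb]
  linarith [key]

/-- **EVERY CROSS-APEX PAIR AT RIM DISTANCE TWO IS NEGATIVELY CORRELATED** (`0 < q ≤ 1`, all weights): for every weighted double fan
(`card V = m + 3`, weights supported on the double-fan pairs) and every `j` with `j + 2 ≤ m`,
`φ(J_{a c_j} ∩ J_{b c_{j+2}}) ≤ φ(J_{a c_j})·φ(J_{b c_{j+2}})` — the middle vertex `c_{j+1}` may carry both its spokes.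
[cite: Grimmett2006, §3.9 eq. (3.94) (pp. 63–64)] -/
theorem negCorr_spokes_cross_two (hcard : Fintype.card V = m + 3) {q : ℝ} (hq0 : 0 < q) (hq1 : q ≤ 1) (w : Sym2 V → unitInterval)
    (hsupp : ∀ e, e ∉ dfPairs a b c m → w e = 0) {j : ℕ} (hj : j + 2 ≤ m) :
    (rcMeasureW w q ∅).real ({ω : BondConfig V | s(a, c j) ∈ ω} ∩ {ω | s(b, c (j + 2)) ∈ ω}) ≤
      (rcMeasureW w q ∅).real {ω : BondConfig V | s(a, c j) ∈ ω} * (rcMeasureW w q ∅).real {ω : BondConfig V | s(b, c (j + 2)) ∈ ω} :=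
  negCorr_spokes_cross_far_multifan_junction hab hinj hca hcb hcard hq0 hq1 w hsupp (ℓ := j) le_rfl le_rfl hj
    (fun i hi hi' => absurd hi' (by omega)) (fun i hi hi' => absurd hi' (by omega))

/-- **The mirror pair `(b c_j, a c_{j+2})`** (the `a ↔ b` relabelling of `negCorr_spokes_cross_two`). [cite: Grimmett2006, §3.9 eq. (3.94) (pp. 63–64)] -/
theorem negCorr_spokes_cross_two' (hcard : Fintype.card V = m + 3) {q : ℝ} (hq0 : 0 < q) (hq1 : q ≤ 1) (w : Sym2 V → unitInterval)
    (hsupp : ∀ e, e ∉ dfPairs a b c m → w e = 0) {j : ℕ} (hj : j + 2 ≤ m) :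
    (rcMeasureW w q ∅).real ({ω : BondConfig V | s(b, c j) ∈ ω} ∩ {ω | s(a, c (j + 2)) ∈ ω}) ≤
      (rcMeasureW w q ∅).real {ω : BondConfig V | s(b, c j) ∈ ω} * (rcMeasureW w q ∅).real {ω : BondConfig V | s(a, c (j + 2)) ∈ ω} :=
  negCorr_spokes_cross_two hab.symm hinj hcb hca hcard hq0 hq1 w (fun e he => hsupp e (by rwa [dfPairs_swap] at he)) hj

/-- The mirror of the junction theorem: `(b c_j, a c_k)` with `w(a c_i) = 0` for `j < i ≤ ℓ` and `w(b c_i) = 0` for `ℓ + 1 < i < k`. [folklore] -/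
theorem negCorr_spokes_cross_far_multifan_junction' (hcard : Fintype.card V = m + 3) {q : ℝ} (hq0 : 0 < q) (hq1 : q ≤ 1)
    (w : Sym2 V → unitInterval) (hsupp : ∀ e, e ∉ dfPairs a b c m → w e = 0)
    {j ℓ k : ℕ} (hjl : j ≤ ℓ) (hlk : ℓ + 2 ≤ k) (hk : k ≤ m) (ha0 : ∀ i, j < i → i ≤ ℓ → w s(a, c i) = 0)
    (hb0 : ∀ i, ℓ + 1 < i → i < k → w s(b, c i) = 0) :
    (rcMeasureW w q ∅).real ({ω : BondConfig V | s(b, c j) ∈ ω} ∩ {ω | s(a, c k) ∈ ω}) ≤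
      (rcMeasureW w q ∅).real {ω : BondConfig V | s(b, c j) ∈ ω} * (rcMeasureW w q ∅).real {ω : BondConfig V | s(a, c k) ∈ ω} :=
  negCorr_spokes_cross_far_multifan_junction hab.symm hinj hcb hca hcard hq0 hq1 w
    (fun e he => hsupp e (by rwa [dfPairs_swap] at he)) hjl hlk hk ha0 hb0

end Setting

end ThreeApex

end FK

end Summit.CriticalPhenomena.PercolationContinuityZ3.Theorems
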